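import Summits.CriticalPhenomena.Statement

/-!
# CriticalPhenomena / IsingEuclidUpgrade — refutations

Problem `CriticalPhenomena`, topic `IsingEuclidUpgrade`. The route thesis
stmt-CriticalPhenomena-0632 is `(E) ∧ (U)` with `(U)` = stmt-CriticalPhenomena-0637, the
"inversion upgrade": *every* correlation family `S` on `ℝ³` which is a pointwise scaling limit
of the critical Ising correlators, non-degenerate, Euclidean invariant and scale covariant with
dimension `Δ` is inversion covariant with the same `Δ`. The scaling-limit hypothesis
(`HasPointwiseScalingLimit`) and non-degeneracy only see `S n` on NON-COINCIDENT configurations,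
whereas `IsEuclideanInvariant`, `IsScaleCovariant`, `IsInversionCovariant` quantify over ALL
configurations. So from any witness `S₀` of the Euclidean limit one manufactures a second family
`S`, equal to `S₀` off the partially coincident locus `{z | ¬ Injective z ∧ ∃ i j, z i ≠ z j}` and
equal to `(∑ᵢⱼ ‖zᵢ - zⱼ‖)^{-nΔ}` on it, which keeps every hypothesis of `(U)` but is not
inversion covariant at `(e, e, 2e)` unless `Δ = 0`. Hence
`CritIsing3DEuclideanLimit → ¬ (U)` and, since `(E)` contains the Euclidean limit with `Δ > 0`,
`¬ ((E) ∧ (U))` outright. Fix for the planner: add to `(U)` the normalisation hypothesis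
`∀ n z, z ∉ NonCoincident 3 n → S n z = 0` (or restrict the three covariance predicates to
non-coincident configurations) and move the normalisation `S ↦ S·𝟙_{NonCoincident}` into the
assembly. [Di Francesco–Mathieu–Sénéchal 1997, §4.3.1; folklore]
-/

namespace Summit.CriticalPhenomena.IsingEuclidUpgrade

open Literature.Probability.LatticeModels Literature.Probability.Percolation EuclideanGeometry Function

/-- Refutes stmt-CriticalPhenomena-0637 `(U)` given the Euclidean scaling limit
(stmt-CriticalPhenomena-0638, also a conjunct of `(E)`): the inversion upgrade quantified over
ALL families `S` (whose values on coincident configurations are unconstrained by the scaling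
limit) fails for the family obtained from a Euclidean-limit witness `S₀` by redefining it as
`(∑ᵢⱼ ‖zᵢ - zⱼ‖)^{-nΔ}` on the partially coincident configurations: that family is still a
scaling limit of `criticalCorr 3`, non-degenerate, Euclidean invariant and scale covariant, but at
`z = (e, e, 2e)`, `‖e‖ = 1`, inversion covariance would read `2^{-3Δ} = 2^{2Δ}·4^{-3Δ}`, i.e.
`Δ = 0`. [folklore] -/
theorem not_inversionUpgrade_of_euclideanLimit (hE : CritIsing3DEuclideanLimit) :
    ¬ (∀ (ρ : ℝ → ℝ) (Δ : ℝ) (S : Literature.Probability.LatticeModels.CorrFamily 3), (∀ δ ∈ Set.Ioc (0:ℝ) 1, 0 < ρ δ) → Literature.Probability.LatticeModels.HasPointwiseScalingLimit (Literature.Probability.LatticeModels.criticalCorr 3) ρ S → Literature.Probability.LatticeModels.IsNondegenerateTwoPoint S → Literature.Probability.LatticeModels.IsEuclideanInvariant S → Literature.Probability.LatticeModels.IsScaleCovariant Δ S → Literature.Probability.LatticeModels.IsInversionCovariant Δ S) := by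
  intro hU
  obtain ⟨ρ, Δ, S₀, hρ, hΔ, hlim, hnd, heuc, hsc⟩ := hE
  classical
  -- the partially coincident locus, the pair sum, and the twisted family
  obtain ⟨Bad, hBad⟩ : ∃ Bad : (n : ℕ) → (Fin n → EuclideanSpace ℝ (Fin 3)) → Prop,
      Bad = fun n z => ¬ Injective z ∧ ∃ i j, z i ≠ z j := ⟨_, rfl⟩
  obtain ⟨pairSum, hps⟩ : ∃ pairSum : (n : ℕ) → (Fin n → EuclideanSpace ℝ (Fin 3)) → ℝ,
      pairSum = fun n z => ∑ i, ∑ j, ‖z i - z j‖ := ⟨_, rfl⟩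
  obtain ⟨S, hS⟩ : ∃ S : CorrFamily 3,
      S = fun n z => if Bad n z then pairSum n z ^ (-(n : ℝ) * Δ) else S₀ n z := ⟨_, rfl⟩
  have bad_comp_iff : ∀ {n : ℕ} {z : Fin n → EuclideanSpace ℝ (Fin 3)}
      {f : EuclideanSpace ℝ (Fin 3) → EuclideanSpace ℝ (Fin 3)}, Injective f →
      (Bad n (f ∘ z) ↔ Bad n z) := fun hf => by
    simp only [hBad, hf.of_comp_iff, Function.comp_apply, hf.ne_iff]
  have S_of_injective : ∀ {n : ℕ} {z : Fin n → EuclideanSpace ℝ (Fin 3)}, Injective z →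
      S n z = S₀ n z := fun hz => by simp [hS, hBad, hz]
  have pairSum_nonneg : ∀ {n : ℕ} (z : Fin n → EuclideanSpace ℝ (Fin 3)), 0 ≤ pairSum n z :=
    fun z => by
      rw [hps]; exact Finset.sum_nonneg fun _ _ => Finset.sum_nonneg fun _ _ => norm_nonneg _
  -- the twisted family satisfies every hypothesis of (U)
  have hlim' : HasPointwiseScalingLimit (criticalCorr 3) ρ S := fun n =>
    (hlim n).congr_right fun z hz => (S_of_injective hz).symm
  have hnd' : IsNondegenerateTwoPoint S := fun z hz => by
    rw [S_of_injective hz]; exact hnd z hz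
  have heuc' : IsEuclideanInvariant S := by
    refine ⟨fun n v z => ?_, fun n R z => ?_⟩
    · have hb : Bad n (fun i => z i + v) ↔ Bad n z :=
        bad_comp_iff (f := fun p => p + v) (add_left_injective v)
      have hp : pairSum n (fun i => z i + v) = pairSum n z := by simp [hps]
      by_cases h : Bad n z
      · simp only [hS, if_pos h, if_pos (hb.2 h), hp]
      · simp only [hS, if_neg h, if_neg (mt hb.1 h), heuc.1 n v z]
    · have hb : Bad n (fun i => R (z i)) ↔ Bad n z := bad_comp_iff (f := R) R.injective
      have hp : pairSum n (fun i => R (z i)) = pairSum n z := by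
        simp [hps, ← map_sub]
      by_cases h : Bad n z
      · simp only [hS, if_pos h, if_pos (hb.2 h), hp]
      · simp only [hS, if_neg h, if_neg (mt hb.1 h), heuc.2 n R z]
  have hsc' : IsScaleCovariant Δ S := by
    intro n c hc z
    have hb : Bad n (fun i => c • z i) ↔ Bad n z :=
      bad_comp_iff (f := fun p => c • p) (smul_right_injective _ hc.ne')
    have hp : pairSum n (fun i => c • z i) = c * pairSum n z := by
      simp [hps, ← smul_sub, norm_smul, abs_of_pos hc, Finset.mul_sum]
    by_cases h : Bad n z
    · simp only [hS, if_pos h, if_pos (hb.2 h), hp]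
      rw [Real.mul_rpow hc.le (pairSum_nonneg z)]
    · simp only [hS, if_neg h, if_neg (mt hb.1 h), hsc n c hc z]
  have hinv := hU ρ Δ S hρ hlim' hnd' heuc' hsc'
  -- evaluate at (e, e, 2e)
  set e : EuclideanSpace ℝ (Fin 3) := EuclideanSpace.single 0 1 with he
  have hne : ‖e‖ = 1 := by simp [he]
  have he0 : e ≠ 0 := by rw [← norm_ne_zero_iff, hne]; exact one_ne_zero
  let z : Fin 3 → EuclideanSpace ℝ (Fin 3) := ![e, e, (2:ℝ) • e]
  have hz0 : ∀ i, z i ≠ 0 := by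
    intro i; fin_cases i <;> simp [z, he0]
  have hbad : Bad 3 z := by
    rw [hBad]
    refine ⟨fun h => ?_, ⟨0, 2, ?_⟩⟩
    · have := @h 0 1 (by simp [z]); exact absurd this (by decide)
    · simp only [z, Matrix.cons_val_zero, Matrix.cons_val_two, Matrix.tail_cons, Matrix.head_cons]
      intro h
      have : (1:ℝ) • e = (2:ℝ) • e := by simpa using h
      exact absurd (smul_left_injective ℝ he0 this) (by norm_num)
  have hinv_e : inversion (0 : EuclideanSpace ℝ (Fin 3)) 1 e = e := by
    simp [inversion, hne]
  have hinv_2e : inversion (0 : EuclideanSpace ℝ (Fin 3)) 1 ((2:ℝ) • e) = (2:ℝ)⁻¹ • e := by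
    simp [inversion, norm_smul, hne, smul_smul]; norm_num
  have hzinv : (fun i => inversion (0 : EuclideanSpace ℝ (Fin 3)) 1 (z i)) =
      ![e, e, (2:ℝ)⁻¹ • e] := by
    funext i; fin_cases i <;> simp [z, hinv_e, hinv_2e]
  have hbad' : Bad 3 ![e, e, (2:ℝ)⁻¹ • e] := by
    rw [hBad]
    refine ⟨fun h => ?_, ⟨0, 2, ?_⟩⟩
    · have := @h 0 1 (by simp); exact absurd this (by decide)
    · simp only [Matrix.cons_val_zero, Matrix.cons_val_two, Matrix.tail_cons, Matrix.head_cons]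
      intro h
      have : (1:ℝ) • e = (2:ℝ)⁻¹ • e := by simpa using h
      exact absurd (smul_left_injective ℝ he0 this) (by norm_num)
  have n1 : ‖e - (2:ℝ) • e‖ = 1 := by
    rw [show e - (2:ℝ) • e = (-1:ℝ) • e by module, norm_smul, hne]; norm_num
  have n2 : ‖(2:ℝ) • e - e‖ = 1 := by
    rw [show (2:ℝ) • e - e = (1:ℝ) • e by module, norm_smul, hne]; norm_num
  have n3 : ‖e - (2:ℝ)⁻¹ • e‖ = 1/2 := by
    rw [show e - (2:ℝ)⁻¹ • e = (1/2:ℝ) • e by module, norm_smul, hne]; norm_num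
  have n4 : ‖(2:ℝ)⁻¹ • e - e‖ = 1/2 := by
    rw [show (2:ℝ)⁻¹ • e - e = (-1/2:ℝ) • e by module, norm_smul, hne]; norm_num
  have hp1 : pairSum 3 z = 4 := by
    simp [hps, z, Fin.sum_univ_three]
    rw [n1, n2]; norm_num
  have hp2 : pairSum 3 ![e, e, (2:ℝ)⁻¹ • e] = 2 := by
    simp only [hps, Fin.sum_univ_three, Matrix.cons_val_zero, Matrix.cons_val_one,
      Matrix.cons_val_two, Matrix.tail_cons, Matrix.head_cons, sub_self, norm_zero, zero_add,
      add_zero, n3, n4]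
    norm_num
  have hprod : (∏ i, ‖z i‖ ^ (2 * Δ)) = (2:ℝ) ^ (2 * Δ) := by
    simp [z, Fin.prod_univ_three, norm_smul, hne]
  have key := hinv 3 z hz0
  rw [hzinv, hprod] at key
  simp only [hS, if_pos hbad, if_pos hbad', hp1, hp2] at key
  -- key : 2 ^ (-3Δ) = 2 ^ (2Δ) * 4 ^ (-3Δ)
  have h4 : (4:ℝ) = 2 ^ (2:ℝ) := by norm_num
  rw [h4, ← Real.rpow_mul (by norm_num), ← Real.rpow_add (by norm_num)] at key
  have hlog := congrArg Real.log key
  rw [Real.log_rpow (by norm_num), Real.log_rpow (by norm_num)] at hlog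
  have h2 : Real.log 2 ≠ 0 := by positivity
  have : (-(3:ℝ) * Δ) = 2 * Δ + 2 * (-(3:ℝ) * Δ) := by
    have := mul_right_cancel₀ h2 hlog; push_cast at this ⊢; linarith
  linarith

/-- Refutes stmt-CriticalPhenomena-0632, the thesis `(E) ∧ (U)` of route IsingEuclidUpgrade,
outright: `(E)` supplies a Euclidean-invariant scale-covariant scaling limit with `Δ > 0`, and
`not_inversionUpgrade_of_euclideanLimit` turns it into a counterexample to `(U)`. [folklore] -/
theorem not_thesis :
    ¬ ((∃ (ρ : ℝ → ℝ) (Δ : ℝ) (S : Literature.Probability.LatticeModels.CorrFamily 3), (∀ δ ∈ Set.Ioc (0:ℝ) 1, 0 < ρ δ) ∧ 0 < Δ ∧ Literature.Probability.LatticeModels.HasPointwiseScalingLimit (Literature.Probability.LatticeModels.criticalCorr 3) ρ S ∧ Literature.Probability.LatticeModels.IsNondegenerateTwoPoint S ∧ Literature.Probability.LatticeModels.IsEuclideanInvariant S ∧ Literature.Probability.LatticeModels.IsScaleCovariant Δ S ∧ Literature.Probability.LatticeModels.HasNontrivialU4 S) ∧ (∀ (ρ : ℝ → ℝ) (Δ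 : ℝ) (S : Literature.Probability.LatticeModels.CorrFamily 3), (∀ δ ∈ Set.Ioc (0:ℝ) 1, 0 < ρ δ) → Literature.Probability.LatticeModels.HasPointwiseScalingLimit (Literature.Probability.LatticeModels.criticalCorr 3) ρ S → Literature.Probability.LatticeModels.IsNondegenerateTwoPoint S → Literature.Probability.LatticeModels.IsEuclideanInvariant S → Literature.Probability.LatticeModels.IsScaleCovariant Δ S → Literature.Probability.LatticeModels.IsInversionCovariant Δ S)) := by
  rintro ⟨⟨ρ, Δ, S, hρ, hΔ, hlim, hnd, heuc, hsc, -⟩, hU⟩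
  exact not_inversionUpgrade_of_euclideanLimit ⟨ρ, Δ, S, hρ, hΔ, hlim, hnd, heuc, hsc⟩ hU

end Summit.CriticalPhenomena.IsingEuclidUpgrade
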